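import Summits.ValiantsHypothesis.ValiantsHypothesis.Theorems.GrenetZeonDualUnipotentThreeHalvesLongMassRankR
import Summits.ValiantsHypothesis.ValiantsHypothesis.Theorems.GrenetZeonTwoDimCoefficientsDefs

/-!
# Crux `GrenetZeon.TwoDimCoefficients` (stmt-ValiantsHypothesis-8062), stub `stub_dualUnipotent` (`DualUnipotentBound`):
# `per_n` HAS DEGREE ≤ r + 1 ALONG EVERY DIRECTION OF COEFFICIENT-RANK r

A structural row for the unipotent dual model `DualUnipotentRepr n m` (`per_n = α·det A + β·tr(adj A·B)`, `A, B` affine, `det A ≡ c`):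
for every base point `x` and every direction `v` whose linear coefficient matrix `lin_v A = (linEntry A i j v)_{ij}` factors through `Fin r`
(rank `≤ r`), the one-variable pull-back `per_n(x + s·v)` has `s`-degree `≤ r + 1` (`totalDegree_lineSubst_perPoly_le`; rank form
`totalDegree_lineSubst_perPoly_le_rank`).  MECHANISM: `adj A(x + s v) = adj(A(x) + s·U·W)` has entries of `s`-degree `≤ r` — each is a
determinant of a rank-`r` perturbation of a complex matrix (✓ `LongMassRankR.totalDegree_det_add_smul_mul_le`, Schur complement + Leibniz count;
here packaged for a general affine pencil as `totalDegree_adjugate_add_smul_mul_le`) — while `det A(x + s v) = c` and the entries of `B(x + s v)`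
are affine in `s`.

This is the `r`-version of the FLATNESS mechanism behind the best proved rung ✓ `two_mul_sq_le_of_dualUnipotentRepr` (`m ≥ √2·n`, p593595:
along `ker(lin A)` — rank `0` — `per_n` is affine, so `dim ker(lin A) ≤ 2n` by ✓ `finrank_le_of_hess0_perPoly_isOrtho`): rank `r` directions are
directions of ORDER-`(r+2)` flatness of `per_n`, so by LEMMA_k (✓ `finrank_le_of_iterD_perPoly_eq_zero`, p593106) every direction subspace on
which `lin A` has rank `≤ r` has dimension `≤ 2(r+1)n` (paper remark; the `r = 0` case is the landed rung's kernel bound).  Read contrapositively: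
the linear part of `A` must convert PERMANENTAL degree into RANK — along any `v` with `per_n(x + s v)` of degree `d` in `s` (e.g. `d = n` for
`v` a permutation matrix), `rank lin_v A ≥ d − 1`.
Honest framing: a support lemma (`--supports stmt-ValiantsHypothesis-8062`); it yields no new rung by itself (bounded-rank subspaces of `M_m` have
codimension `≥ m(m − r)`, so the dimension count only returns `m ≳ n/2`); `DualUnipotentBound`, the crux 8062, 24318 and `VP ≠ VNP` remain OPEN /
NOT proved.  No sorry, no definitions, no named facts.
-/

-- single-conjunct layout: Sub = Summit, duplicated namespace component intended (the name is mandated)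
set_option linter.dupNamespace false
set_option autoImplicit false

noncomputable section

namespace Summit.ValiantsHypothesis.ValiantsHypothesis.Cruxes.TwoDimCoefficients.DimTwoCases.RankFlat

open MvPolynomial Matrix
open Literature.Computability.AlgebraicComplexity (perPoly)
open Summit.ValiantsHypothesis.ValiantsHypothesis.Cruxes.TwoDimCoefficients.DimTwoCases (AffMat IsAffine DualUnipotentRepr)
open Summit.ValiantsHypothesis.ValiantsHypothesis.Theorems.GrenetZeon.RadicalSplit (lineSubst)
open Summit.ValiantsHypothesis.ValiantsHypothesis.Theorems.GrenetZeon.SlowCore (linEntry lineSubst_apply_of_le_one totalDegree_lineSubst_le_one)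
open Summit.ValiantsHypothesis.ValiantsHypothesis.Theorems.GrenetZeon.LongMassRankR
  (totalDegree_det_add_smul_mul_le updateRow_pencil updateRow_zero_mul map_lineSubst_eq_of_factor exists_factor_of_rank)

variable {n m r : ℕ}

/-- **Adjugate entries of a rank-`r`-perturbed complex matrix have `s`-degree `≤ r`**: for complex `G` (`m × m`), `U` (`m × r`), `W` (`r × m`),
every entry of `adj(G + s·U·W)` over `ℂ[s]` has `s`-degree `≤ r` (a determinant with one row replaced by a basis vector is still a rank-`r`
perturbation of a complex matrix). [this file; ✓ `LongMassRankR.totalDegree_det_add_smul_mul_le`] -/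
theorem totalDegree_adjugate_add_smul_mul_le (G : Matrix (Fin m) (Fin m) ℂ) (U : Matrix (Fin m) (Fin r) ℂ)
    (W : Matrix (Fin r) (Fin m) ℂ) (i j : Fin m) :
    ((G.map (C : ℂ → MvPolynomial (Fin 1) ℂ) + (X 0 : MvPolynomial (Fin 1) ℂ) • (U * W).map (C : ℂ → MvPolynomial (Fin 1) ℂ)).adjugate
      i j).totalDegree ≤ r := by
  rw [Matrix.adjugate_apply, updateRow_pencil, ← updateRow_zero_mul]
  exact totalDegree_det_add_smul_mul_le _ _ _

/-- ★ **`per_n` has `s`-degree `≤ r + 1` along every direction of coefficient-rank `≤ r`** (factorised form).  In the unipotent dual model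
`per_n = α·det A + β·tr(adj A·B)` (`det A ≡ c`), for every base point `x` and direction `v` with `lin_v A = U·W` through `Fin r`:
`deg_s per_n(x + s v) ≤ r + 1`. [this file] -/
theorem totalDegree_lineSubst_perPoly_le (α β c : ℂ) (A B : AffMat n m) (hA : IsAffine A) (hB : IsAffine B)
    (hdet : A.det = MvPolynomial.C c)
    (hper : perPoly (Fin n) ℂ = MvPolynomial.C α * A.det + MvPolynomial.C β * (A.adjugate * B).trace)
    (x v : Fin n × Fin n → ℂ) (U : Matrix (Fin m) (Fin r) ℂ) (W : Matrix (Fin r) (Fin m) ℂ)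
    (hv : ∀ i j, linEntry A i j v = (U * W) i j) :
    (lineSubst x v (perPoly (Fin n) ℂ)).totalDegree ≤ r + 1 := by
  set φ := lineSubst x v with hφ
  -- push the substitution through the representation
  have hC : ∀ a : ℂ, φ (MvPolynomial.C a) = MvPolynomial.C a := fun a => by
    rw [MvPolynomial.algHom_C, MvPolynomial.algebraMap_eq]
  have hadj : (A.adjugate).map φ = (A.map φ).adjugate := by
    have h := RingHom.map_adjugate φ.toRingHom A
    rw [RingHom.mapMatrix_apply, RingHom.mapMatrix_apply] at h
    exact h
  have hrepr : φ (perPoly (Fin n) ℂ) =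
      MvPolynomial.C α * MvPolynomial.C c + MvPolynomial.C β * ((A.map φ).adjugate * B.map φ).trace := by
    rw [hper, map_add, map_mul, map_mul, hdet, hC, hC, hC, AddMonoidHom.map_trace φ (A.adjugate * B), Matrix.map_mul,
      hadj]
  -- the pulled-back `A` is a rank-`r` perturbation of `A(x)`
  have hAφ : A.map φ = (A.map (eval x)).map (C : ℂ → MvPolynomial (Fin 1) ℂ) +
      (X 0 : MvPolynomial (Fin 1) ℂ) • (U * W).map (C : ℂ → MvPolynomial (Fin 1) ℂ) :=
    map_lineSubst_eq_of_factor A hA x v U W hv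
  rw [hrepr]
  refine (totalDegree_add _ _).trans (max_le ?_ ?_)
  · refine (totalDegree_mul _ _).trans ?_
    rw [totalDegree_C, totalDegree_C]
    exact Nat.zero_le _
  · refine (totalDegree_mul _ _).trans ?_
    rw [totalDegree_C, zero_add, Matrix.trace]
    refine (totalDegree_finsetSum _ _).trans (Finset.sup_le fun i _ => ?_)
    rw [Matrix.diag_apply, Matrix.mul_apply]
    refine (totalDegree_finsetSum _ _).trans (Finset.sup_le fun j _ => ?_)
    refine (totalDegree_mul _ _).trans ?_
    have h1 : ((A.map φ).adjugate i j).totalDegree ≤ r := by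
      rw [hAφ]; exact totalDegree_adjugate_add_smul_mul_le _ U W i j
    have h2 : ((B.map φ) j i).totalDegree ≤ 1 := by
      rw [Matrix.map_apply]; exact totalDegree_lineSubst_le_one x v (hB j i)
    omega

/-- ★ **RANK FORM.**  The same with the hypothesis `rank (lin_v A) ≤ r` (factorise through `Fin (rank)` by ✓ `exists_factor_of_rank`). [this file] -/
theorem totalDegree_lineSubst_perPoly_le_rank (α β c : ℂ) (A B : AffMat n m) (hA : IsAffine A) (hB : IsAffine B)
    (hdet : A.det = MvPolynomial.C c)
    (hper : perPoly (Fin n) ℂ = MvPolynomial.C α * A.det + MvPolynomial.C β * (A.adjugate * B).trace)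
    (x v : Fin n × Fin n → ℂ) (hr : (Matrix.of fun i j : Fin m => linEntry A i j v).rank ≤ r) :
    (lineSubst x v (perPoly (Fin n) ℂ)).totalDegree ≤ r + 1 := by
  obtain ⟨U, W, hUW⟩ := exists_factor_of_rank (Matrix.of fun i j : Fin m => linEntry A i j v)
  have h := totalDegree_lineSubst_perPoly_le α β c A B hA hB hdet hper x v U W
    (fun i j => by rw [← hUW, Matrix.of_apply])
  exact h.trans (Nat.add_le_add_right hr 1)

/-- ★ **MODEL FORM.**  `DualUnipotentRepr n m` ⇒ there is an affine `m × m` pencil `A` (the unipotent factor of the representation) such that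
`per_n(x + s v)` has `s`-degree `≤ rank(lin_v A) + 1` for ALL `x, v`: the linear part of `A` converts permanental degree into rank. [this file] -/
theorem exists_pencil_degree_le_rank_of_dualUnipotentRepr (h : DualUnipotentRepr n m) :
    ∃ A : AffMat n m, IsAffine A ∧ ∀ x v : Fin n × Fin n → ℂ,
      (lineSubst x v (perPoly (Fin n) ℂ)).totalDegree ≤ (Matrix.of fun i j : Fin m => linEntry A i j v).rank + 1 := by
  obtain ⟨α, β, c, A, B, hA, hB, _, hdet, hper⟩ := h
  exact ⟨A, hA, fun x v => totalDegree_lineSubst_perPoly_le_rank α β c A B hA hB hdet hper x v le_rfl⟩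

end Summit.ValiantsHypothesis.ValiantsHypothesis.Cruxes.TwoDimCoefficients.DimTwoCases.RankFlat

end
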